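import Literature.AlgebraicGeometry.Frobenioids.Thm36SubRlfModel
import Literature.AlgebraicGeometry.Frobenioids.ArchimedeanStandardType
import HarnessLib

/-!
# Frobenioids II, Theorem 3.6 (i) for `C^ℚ := C^pf`, `C^ℝ := C^rlf` — the clauses NOT restated in `Thm36Sub.lean`
# («model type», «characteristic splitting», «`(C^Λ)^un-tr ⥲ C^ℝ`»): sub-DAG statements file (slots)

Mochizuki, *The geometry of Frobenioids II: poly-Frobenioids*, Kyushu J. Math. **62** (2008) 401–460, §3,
Theorem 3.6 (i), kurims text p. 36 [cite: MochizukiFrdII2008, Thm 3.6 (i) p.36]: "denote by `Φ^∡` the restriction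
`Φ^∡_0|_D` … `Spec(K) ↦ O_K^×` and by `Φ^fld` the functor `D → Mon` given by `D ↦ Φ^gp(D) × Φ^∡(D)` … If `Λ = ℤ`
(respectively, `Λ = ℚ`; `Λ = ℝ`), then write `(Φ^fld)^Λ := Φ^fld` (respectively, `(Φ^fld)^Λ := (Φ^fld)^pf`;
`(Φ^fld)^Λ := Φ^gp`). Then: (i) The Frobenioid `(C^Λ)^istr` is of isotropic, base-trivial, and model type, with
rational function monoid naturally isomorphic to `(Φ^fld)^Λ`; the canonical decomposition of Definition 3.1,
(ii), determines a characteristic splitting [cf. [Mzk5], Definition 2.3] on `C^Λ`. If `Λ ≥ ℚ`, then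
`(C^Λ)^istr = C^Λ`. For arbitrary `Λ`, there is a natural equivalence of categories `(C^Λ)^un-tr ⥲ C^ℝ`,
compatible with the Frobenioid structures; …"

WHY THIS FILE (abc-iut cell, L1 row M13-c; L1-lead R108 (9)(g) GO; seat abc-iut-w4-d074).  `Thm36Sub.lean`
(p412774) restated the `Λ ∈ {ℚ, ℝ}` conjuncts of abc-iut-L1-t9's `Λ`-indexed instance statements over THE
completions `C^ℚ := C^pf` (`pfCompletion`) and `C^ℝ := C^rlf` (`rlfCompletion`) — all 20 slots are closed in the
tree (`Thm36SubInstancesA/B.lean`) — and RECORDED three clauses of (i) as not restated: "model type with rational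
function monoid `(Φ^fld)^Λ`", "`(C^Λ)^un-tr ⥲ C^ℝ`" and the characteristic splitting.  Status now:
* **«model type», `Λ = ℝ`** — PROVED, no slot needed: `Thm36Sub.istrModel_R_holds` (`Thm36SubRlfModel.lean`
  p421207) : `Thm36i_istrModel (rlfStr π) (ModelFrobenioid.toElem Φ^rlf Φ^gp ι^gp)`, i.e. `(C^rlf)^istr` is
  equivalent over `F_{Φ^rlf}` to the model Frobenioid ([FrdI] Thm. 5.2) of `(Φ^rlf, (Φ^fld)^ℝ = Φ^gp, ι^gp)`.
* **«`(C^Λ)^un-tr ⥲ C^ℝ` compatible with the Frobenioid structures», `Λ = ℤ` and `Λ = ℝ`** — SLOTS below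
  (`untrEquiv_Z`, `untrEquiv_R`), in the typed form of t9's generic predicate `Thm36i_untrEquiv FU FR`
  (`ArchimedeanBasicProperties.lean`: "over the unit-trivialisation `(C^Λ)^un-tr → F_Φ` and `C^ℝ → F_Φ` as
  parameters"): `(C^Λ)^un-tr` in its MODEL DESCRIPTION `untrModel` = the model Frobenioid of `(Φ^Λ, (Φ^Λ)^birat)`
  ([FrdI] Prop. 5.3, `FrobenioidRealification(Canonical).lean`; the comparison of the categorical unit-trivialisation
  with this model is abc-iut-L1-d5's `UnitTrivializationModelComparison*`), read in `F_{Φ^rlf}` through the natural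
  homomorphism `Φ^Λ → Φ^rlf` of divisor monoids (`ElemFrobenioid.mapNatTrans`; the identity at `Λ = ℝ`) — this is
  how "compatible with the Frobenioid structures" is made precise across the two divisor monoids.
* **«characteristic splitting», `Λ = ℝ`** — SLOT `charSplitting_R` = t9's generic `Thm36i_charSplitting (rlfStr π)`
  with `radial A t := t ∈ O^▷(A)`: at `Λ = ℝ` the factor `O_K^×` of the canonical decomposition `K^× = O_K^× × ord(K^×)`
  (Def. 3.1 (ii)) dies (`O^×(A) = {1}` in `C^rlf`, Thm. 3.6 (v) (c)), so the splitting it determines is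
  `τ(A) = O^▷(A)` (the `Λ = ℤ` instance is t9's `thm36i_charSplitting_C`, `ArchimedeanCharSplitting.lean`).
* NOT typed here (recorded, with the reason): the `Λ = ℚ` versions — «model type» with `(Φ^fld)^ℚ = (Φ^fld)^pf`,
  «`(C^ℚ)^un-tr ⥲ C^ℝ`» and the characteristic splitting on `C^pf`.  The divisor monoid of THE perfection,
  `(PreFrobenioid.Perfection.ops hF).monFunctor`, IS `Φ^pf` objectwise (`PerfectionOps.lean`), but the literal datum
  `(Φ^fld)^pf → (Φ^pf)^gp` needs the perfection/groupification interchange `Perfection (M^gp) → (Perfection M)^gp`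
  (not in the tree) and the identification of the rational-function monoid of `C^pf` needs a levelwise description of
  the birational units of `(A, n)` — abc-iut-L1-t6's design `M13-c3-DESIGN.md` (pieces P0–P4, L-sized); left to
  that row.
Each slot is ONE `def … : Prop` (nothing asserted; typed ≠ proved) whose docstring carries the printed clause, the
locator and a «SLOT» line; no notion of the paper is (re)defined.  Nothing here takes a side on [IUTchIII] Cor. 3.12.
-/

noncomputable section

namespace Literature.AlgebraicGeometry.Frobenioids

open CategoryTheory Opposite Literature.AnabelianGeometry.EtaleTheta
open scoped NNReal

universe v u

namespace ArchFrd

namespace Thm36Sub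

variable {D : Type u} [Category.{v} D] (π : D ⥤ D0)

/-! ### Theorem 3.6 (i): "`(C^Λ)^un-tr ⥲ C^ℝ`, compatible with the Frobenioid structures" -/

/-- **Thm. 3.6 (i)** (p. 36): "For arbitrary `Λ`, there is a natural equivalence of categories `(C^Λ)^un-tr ⥲ C^ℝ`,
compatible with the Frobenioid structures", at `Λ = ℤ`: the unit-trivialisation `C^un-tr` of `C` in its model
description ([FrdI] Prop. 5.3: the model Frobenioid of `(Φ, Φ^birat)`, `PreFrobenioid.untrModel (C.toElem π)`), with
its structure functor read in `F_{Φ^rlf}` along `ι : Φ → Φ^rlf`, is equivalent over `F_{Φ^rlf}` to THE realification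
`C^ℝ = C^rlf` (t9's `Thm36i_untrEquiv`). SLOT: `ι` is bijective for the archimedean Frobenioid
(`bijective_toRlf_app`) and `Φ^birat = Φ^gp`, `ℝ · Φ^birat = (Φ^rlf)^gp` (`biratSubfunctor_carrier_eq_top`,
`realSpan_carrier_eq_top`), so [FrdI] Prop. 5.3's `C^un-tr → C^rlf` is an equivalence
(`ModelFrobenioid.DataHomOver.functor_isEquivalence`). [cite: MochizukiFrdII2008, Thm 3.6 (i) p.36] -/
def untrEquiv_Z : Prop :=
  Thm36i_untrEquiv
    (ModelFrobenioid.toElem (Φ π) (PreFrobenioid.biratSubfunctor (C.toElem π)).toMonoid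
        (PreFrobenioid.biratSubfunctor (C.toElem π)).incl ⋙
      ElemFrobenioid.mapNatTrans
        (RealificationData.canonical (Φ π) (PreFrobenioid.IsPerfFactorialOn.op (isPerfFactorialOn_Φ π))).toRlf)
    (rlfStr π)

/-- **Thm. 3.6 (i)** (p. 36): "`(C^Λ)^un-tr ⥲ C^ℝ`, compatible with the Frobenioid structures", at `Λ = ℝ`: the
unit-trivialisation of `C^ℝ = C^rlf` in its model description (the model Frobenioid of `(Φ^rlf, (Φ^rlf)^birat)`,
`PreFrobenioid.untrModel (rlfStr π)`) is equivalent over `F_{Φ^rlf}` to `C^rlf` itself. SLOT: `(Φ^rlf)^birat` of the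
model Frobenioid `C^rlf` is all of `(Φ^rlf)^gp` (pre-steps `(1, id, z, u)` exist for every `z`), so the morphism of
model data `((Φ^rlf)^birat ↪ ℝ · Φ^birat = (Φ^rlf)^gp)` over the identity induces an equivalence.
[cite: MochizukiFrdII2008, Thm 3.6 (i) p.36] -/
def untrEquiv_R : Prop :=
  Thm36i_untrEquiv
    (ModelFrobenioid.toElem
      (rlfFunctor (Φ π) (PreFrobenioid.IsPerfFactorialOn.op (isPerfFactorialOn_Φ π)))
      (PreFrobenioid.biratSubfunctor (rlfStr π)).toMonoid (PreFrobenioid.biratSubfunctor (rlfStr π)).incl)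
    (rlfStr π)

/-! ### Theorem 3.6 (i): the characteristic splitting on `C^ℝ` -/

/-- **Thm. 3.6 (i)** (p. 36): "the canonical decomposition of Definition 3.1, (ii), determines a characteristic
splitting [cf. [Mzk5], Definition 2.3] on `C^Λ`", at `Λ = ℝ`, in the typed form of abc-iut-L1-t9's generic predicate
`ArchFrd.Thm36i_charSplitting F radial` (`ArchimedeanStandardType.lean`; instantiated at `Λ = ℤ` by
`Thm36i_charSplitting_C` / `thm36i_charSplitting_C`, `ArchimedeanCharSplitting.lean`): `C^ℝ = C^rlf` carries a
characteristic splitting ([FrdI] Def. 2.3, abc-iut-L1-t2's `PreFrobenioid.CharacteristicSplitting`) whose value at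
every (isotropic — i.e. every) object is ALL of `O^▷(A)`: at `Λ = ℝ` the factor `O_K^×` of the canonical decomposition
`K^× = O_K^× × ord(K^×)` is killed (`O^×(A) = {1}`, Thm. 3.6 (v) (c), `rlf_unitsSubgroup_eq_bot`), so "radial" =
"element of `O^▷(A)`". SLOT: `τ A := O^▷(A)`; (a) holds because `O^×(A)` is trivial, (b) because every object of
`C^rlf` is isotropic (isotropic hulls are isomorphisms). [cite: MochizukiFrdII2008, Thm 3.6 (i) p.36] -/
def charSplitting_R : Prop :=
  Thm36i_charSplitting (rlfStr π) fun A t => t ∈ PreFrobenioid.endSubmonoid (rlfStr π) A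

end Thm36Sub

end ArchFrd

end Literature.AlgebraicGeometry.Frobenioids

end
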